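import Summits.Ventures.HodgeRepro2.T5FockFFT

/-!
# The bidegree-(1,1) part of the Fock polynomial ring as `M₃(ℂ)`, and the `U(3)`-action on it (support, seat p1)

Census item U2 of `route/t7/Line3/REPAIR-CENSUS.md` §C (L3-ARGUMENT §4a (a)), first half: the 9-dimensional space of
bidegree-(1,1) polynomials in the Fock variables `w_{i,0}, w_{i,1}` (`i : Fin 3`; the Tier-5 base `T5FockInvariants`,
`Q = Σ_i w_{i,0} w_{i,1}`, the `U(3)`-substitution `T5FockWeights.unitaryAct`) and the action on it:

* `ofMatrix A = Σ_{i,k} A i k · w_{i,0} w_{k,1}` — the (1,1)-space as the image of `M₃(ℂ)`: `coeff_ofMatrix`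
  (the coefficient of `w_{i,0} w_{k,1}` is `A i k`), `ofMatrix_injective`, linearity, `ofMatrix_one : ofMatrix 1 = Q`,
  `ofMatrix_single : ofMatrix (single i₀ i₁ 1) = w_{i₀,0} w_{i₁,1}`;
* `unitaryAct_ofMatrix` — `unitaryAct u (ofMatrix A) = ofMatrix (matAct u A)` with `matAct u A = ū · A · uᵀ`, for EVERY
  matrix `u` (the base's substitution `w_{i,0} ↦ Σ_j conj(u_{ji}) w_{j,0}`, `w_{i,1} ↦ Σ_j u_{ji} w_{j,1}`);
* `trace_matAct` — for a unitary `u` (`u * uᴴ = 1`) the trace of the coefficient matrix is invariant; `matAct_one`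
  (the identity, i.e. `Q`, is fixed), `matAct_smul`, `matAct_sub`.

The decomposition `trace ⊕ traceless`, its canonicity and the rule «`w_{i₀,0} w_{i₁,1}` has a non-zero trace component
iff `i₀ = i₁`» are in `T7SupportFockTraceDecomposition`. Finite-dimensional linear algebra only; nothing about any
period, (N) or (P). Blind lane: Mathlib + the HodgeRepro2 prefix only; no sorry; axioms ⊆ {propext, Classical.choice,
Quot.sound}.
-/

namespace Summit.Ventures.HodgeRepro2.T7SupportFockBidegreeOneOne

open MvPolynomial Matrix
open T5FockInvariants T5FockWeights

/-- The exponent of the bidegree-(1,1) monomial `w_{i,0} w_{k,1}`. -/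
noncomputable def e (i k : Fin 3) : Var →₀ ℕ := Finsupp.single (i, 0) 1 + Finsupp.single (k, 1) 1

/-- The bidegree-(1,1) polynomial with coefficient matrix `A`: `Σ_{i,k} A i k · w_{i,0} w_{k,1}`. -/
noncomputable def ofMatrix (A : Matrix (Fin 3) (Fin 3) ℂ) : MvPolynomial Var ℂ :=
  ∑ i, ∑ k, C (A i k) * (X (i, 0) * X (k, 1))

/-- The action of a matrix `u` on coefficient matrices induced by `unitaryAct u`: `A ↦ ū · A · uᵀ`. -/
noncomputable def matAct (u A : Matrix (Fin 3) (Fin 3) ℂ) : Matrix (Fin 3) (Fin 3) ℂ := u.map star * A * uᵀ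

/-! ### The monomials `w_{i,0} w_{k,1}` and their exponents -/

/-- `w_{i,0} w_{k,1}` is the monomial with exponent `e i k`. -/
theorem X_mul_X_eq_monomial (i k : Fin 3) : (X (i, 0) * X (k, 1) : MvPolynomial Var ℂ) = monomial (e i k) 1 := by
  rw [← pow_one (X (i, 0) : MvPolynomial Var ℂ), ← pow_one (X (k, 1) : MvPolynomial Var ℂ), X_pow_eq_monomial,
    X_pow_eq_monomial, monomial_mul, one_mul]
  rfl

/-- The exponent `e i k` at a first-column variable. -/
theorem e_apply_zero (i k j : Fin 3) : e i k (j, 0) = if i = j then 1 else 0 := by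
  simp [e, Finsupp.single_apply]

/-- The exponent `e i k` at a second-column variable. -/
theorem e_apply_one (i k j : Fin 3) : e i k (j, 1) = if k = j then 1 else 0 := by
  simp [e, Finsupp.single_apply]

/-- The exponents `e i k` are pairwise distinct. -/
theorem e_inj {i k i' k' : Fin 3} : e i k = e i' k' ↔ i = i' ∧ k = k' := by
  constructor
  · intro h
    have h0 := congrArg (fun d : Var →₀ ℕ => d (i, 0)) h
    have h1 := congrArg (fun d : Var →₀ ℕ => d (k, 1)) h
    simp only [e_apply_zero, e_apply_one, if_true] at h0 h1
    refine ⟨?_, ?_⟩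
    · by_contra hne
      rw [if_neg (Ne.symm hne)] at h0
      exact one_ne_zero h0
    · by_contra hne
      rw [if_neg (Ne.symm hne)] at h1
      exact one_ne_zero h1
  · rintro ⟨rfl, rfl⟩
    rfl

/-- The total degree of `e i k` is `2`. -/
theorem degree_e (i k : Fin 3) : Finsupp.degree (e i k) = 2 := by
  simp [e, map_add, Finsupp.degree_single]

/-! ### `ofMatrix`: the (1,1)-space as the image of `M₃(ℂ)` -/

/-- The coefficient of `w_{i,0} w_{k,1}` in `ofMatrix A` is `A i k`. -/
theorem coeff_ofMatrix (A : Matrix (Fin 3) (Fin 3) ℂ) (i k : Fin 3) : coeff (e i k) (ofMatrix A) = A i k := by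
  simp only [ofMatrix, X_mul_X_eq_monomial, coeff_sum, coeff_C_mul, coeff_monomial, e_inj]
  rw [Finset.sum_eq_single i]
  · rw [Finset.sum_eq_single k]
    · simp
    · intro k' _ hk'
      simp [hk']
    · intro h
      exact absurd (Finset.mem_univ k) h
  · intro i' _ hi'
    simp [hi']
  · intro h
    exact absurd (Finset.mem_univ i) h

/-- `ofMatrix` is injective. -/
theorem ofMatrix_injective : Function.Injective ofMatrix := by
  intro A B h
  ext i k
  rw [← coeff_ofMatrix A i k, ← coeff_ofMatrix B i k, h]

/-- `ofMatrix` is additive. -/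
theorem ofMatrix_add (A B : Matrix (Fin 3) (Fin 3) ℂ) : ofMatrix (A + B) = ofMatrix A + ofMatrix B := by
  simp [ofMatrix, Finset.sum_add_distrib, add_mul]

/-- `ofMatrix` commutes with scalars. -/
theorem ofMatrix_smul (c : ℂ) (A : Matrix (Fin 3) (Fin 3) ℂ) : ofMatrix (c • A) = c • ofMatrix A := by
  simp [ofMatrix, Finset.smul_sum, smul_eq_C_mul, mul_assoc]

/-- `ofMatrix 0 = 0`. -/
theorem ofMatrix_zero : ofMatrix 0 = 0 := by
  simp [ofMatrix]

/-- `ofMatrix A = 0` iff `A = 0`. -/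
theorem ofMatrix_eq_zero_iff (A : Matrix (Fin 3) (Fin 3) ℂ) : ofMatrix A = 0 ↔ A = 0 := by
  constructor
  · intro h
    exact ofMatrix_injective (h.trans ofMatrix_zero.symm)
  · rintro rfl
    exact ofMatrix_zero

/-- The identity matrix gives the invariant `Q = Σ_i w_{i,0} w_{i,1}`. -/
theorem ofMatrix_one : ofMatrix 1 = Q := by
  simp [ofMatrix, Q, Matrix.one_apply, apply_ite C, ite_mul]

/-- The coefficient of `w_{i,0} w_{k,1}` in `Q` is `[i = k]`. -/
theorem coeff_Q (i k : Fin 3) : coeff (e i k) Q = if i = k then 1 else 0 := by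
  rw [← ofMatrix_one, coeff_ofMatrix, Matrix.one_apply]

/-- The elementary matrix gives the monomial `w_{i₀,0} w_{i₁,1}`. -/
theorem ofMatrix_single (i₀ i₁ : Fin 3) : ofMatrix (single i₀ i₁ (1 : ℂ)) = X (i₀, 0) * X (i₁, 1) := by
  simp only [ofMatrix, single_apply, apply_ite C, C_1, C_0, ite_mul, one_mul, zero_mul]
  rw [Finset.sum_eq_single i₀]
  · rw [Finset.sum_eq_single i₁]
    · simp
    · intro k' _ hk'
      simp [Ne.symm hk']
    · intro h
      exact absurd (Finset.mem_univ i₁) h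
  · intro i' _ hi'
    simp [Ne.symm hi']
  · intro h
    exact absurd (Finset.mem_univ i₀) h

/-! ### The action of `unitaryAct u` on the (1,1)-space -/

/-- `unitaryAct u` on a first-column variable. -/
theorem unitaryAct_X_zero (u : Matrix (Fin 3) (Fin 3) ℂ) (i : Fin 3) :
    unitaryAct u (X (i, 0)) = ∑ j, C (star (u j i)) * X (j, 0) := by
  simp [unitaryAct]

/-- `unitaryAct u` on a second-column variable. -/
theorem unitaryAct_X_one (u : Matrix (Fin 3) (Fin 3) ℂ) (i : Fin 3) :
    unitaryAct u (X (i, 1)) = ∑ j, C (u j i) * X (j, 1) := by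
  simp [unitaryAct]

/-- `unitaryAct u` fixes constants. -/
theorem unitaryAct_C (u : Matrix (Fin 3) (Fin 3) ℂ) (a : ℂ) : unitaryAct u (C a) = C a := by
  simp [unitaryAct]

/-- `unitaryAct u` on the monomial `w_{i,0} w_{k,1}`. -/
theorem unitaryAct_X_mul_X (u : Matrix (Fin 3) (Fin 3) ℂ) (i k : Fin 3) :
    unitaryAct u (X (i, 0) * X (k, 1)) = ∑ j, ∑ l, C (star (u j i) * u l k) * (X (j, 0) * X (l, 1)) := by
  rw [map_mul, unitaryAct_X_zero, unitaryAct_X_one, Finset.sum_mul_sum]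
  refine Finset.sum_congr rfl fun j _ => Finset.sum_congr rfl fun l _ => ?_
  rw [map_mul (C : ℂ →+* MvPolynomial Var ℂ)]
  ring

/-- Reordering a fourfold sum over `Fin 3`. -/
theorem sum_comm₄ {M : Type*} [AddCommMonoid M] (f : Fin 3 → Fin 3 → Fin 3 → Fin 3 → M) :
    ∑ i, ∑ k, ∑ j, ∑ l, f i k j l = ∑ j, ∑ l, ∑ k, ∑ i, f i k j l := by
  calc ∑ i, ∑ k, ∑ j, ∑ l, f i k j l
      = ∑ i, ∑ j, ∑ k, ∑ l, f i k j l := Finset.sum_congr rfl fun i _ => Finset.sum_comm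
    _ = ∑ j, ∑ i, ∑ k, ∑ l, f i k j l := Finset.sum_comm
    _ = ∑ j, ∑ i, ∑ l, ∑ k, f i k j l :=
        Finset.sum_congr rfl fun j _ => Finset.sum_congr rfl fun i _ => Finset.sum_comm
    _ = ∑ j, ∑ l, ∑ i, ∑ k, f i k j l := Finset.sum_congr rfl fun j _ => Finset.sum_comm
    _ = ∑ j, ∑ l, ∑ k, ∑ i, f i k j l :=
        Finset.sum_congr rfl fun j _ => Finset.sum_congr rfl fun l _ => Finset.sum_comm

/-- `unitaryAct u` on one term `a · w_{i,0} w_{k,1}` of `ofMatrix`. -/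
theorem unitaryAct_term (u : Matrix (Fin 3) (Fin 3) ℂ) (a : ℂ) (i k : Fin 3) :
    unitaryAct u (C a * (X (i, 0) * X (k, 1))) =
      ∑ j, ∑ l, C (star (u j i) * a * u l k) * (X (j, 0) * X (l, 1)) := by
  rw [map_mul, unitaryAct_C, unitaryAct_X_mul_X, Finset.mul_sum]
  refine Finset.sum_congr rfl fun j _ => ?_
  rw [Finset.mul_sum]
  refine Finset.sum_congr rfl fun l _ => ?_
  rw [map_mul (C : ℂ →+* MvPolynomial Var ℂ), map_mul (C : ℂ →+* MvPolynomial Var ℂ),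
    map_mul (C : ℂ →+* MvPolynomial Var ℂ)]
  ring

/-- **`unitaryAct u` acts on coefficient matrices by `A ↦ ū · A · uᵀ`** (every matrix `u`). -/
theorem unitaryAct_ofMatrix (u A : Matrix (Fin 3) (Fin 3) ℂ) :
    unitaryAct u (ofMatrix A) = ofMatrix (matAct u A) := by
  have lhs : unitaryAct u (ofMatrix A) =
      ∑ i, ∑ k, ∑ j, ∑ l, C (star (u j i) * A i k * u l k) * (X (j, 0) * X (l, 1)) := by
    simp only [ofMatrix, map_sum, unitaryAct_term]
  have rhs : ofMatrix (matAct u A) =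
      ∑ j, ∑ l, ∑ k, ∑ i, C (star (u j i) * A i k * u l k) * (X (j, 0) * X (l, 1)) := by
    simp only [ofMatrix, matAct, Matrix.mul_apply, Matrix.map_apply, Matrix.transpose_apply, Finset.sum_mul,
      map_sum]
  rw [lhs, rhs, sum_comm₄]

/-- `ū = (uᴴ)ᵀ`. -/
theorem map_star_eq (u : Matrix (Fin 3) (Fin 3) ℂ) : u.map star = uᴴᵀ := by
  ext i j
  simp [Matrix.conjTranspose_apply, Matrix.transpose_apply, Matrix.map_apply]

/-- `matAct u A = (u · Aᵀ · uᴴ)ᵀ`. -/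
theorem matAct_eq_transpose (u A : Matrix (Fin 3) (Fin 3) ℂ) : matAct u A = (u * Aᵀ * uᴴ)ᵀ := by
  rw [matAct, map_star_eq, Matrix.transpose_mul, Matrix.transpose_mul, Matrix.transpose_transpose, Matrix.mul_assoc]

/-- **The trace is invariant under the action of a unitary matrix.** -/
theorem trace_matAct {u : Matrix (Fin 3) (Fin 3) ℂ} (hu : u * uᴴ = 1) (A : Matrix (Fin 3) (Fin 3) ℂ) :
    (matAct u A).trace = A.trace := by
  rw [matAct_eq_transpose, Matrix.trace_transpose, Matrix.trace_mul_cycle, mul_eq_one_comm.mp hu, Matrix.one_mul,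
    Matrix.trace_transpose]

/-- The identity matrix is fixed by a unitary `u`. -/
theorem matAct_one {u : Matrix (Fin 3) (Fin 3) ℂ} (hu : u * uᴴ = 1) : matAct u 1 = 1 := by
  rw [matAct_eq_transpose, Matrix.transpose_one, Matrix.mul_one, hu, Matrix.transpose_one]

/-- `matAct u` is linear: scalars. -/
theorem matAct_smul (u : Matrix (Fin 3) (Fin 3) ℂ) (c : ℂ) (A : Matrix (Fin 3) (Fin 3) ℂ) :
    matAct u (c • A) = c • matAct u A := by
  simp [matAct]

/-- `matAct u` is linear: differences. -/
theorem matAct_sub (u A B : Matrix (Fin 3) (Fin 3) ℂ) : matAct u (A - B) = matAct u A - matAct u B := by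
  simp [matAct, Matrix.mul_sub, Matrix.sub_mul]

end Summit.Ventures.HodgeRepro2.T7SupportFockBidegreeOneOne
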